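import Summits.BirchSwinnertonDyer.Rank1Residual.Supersingular.SprungPollackConsistency
import Summits.BirchSwinnertonDyer.Rank1Residual.Supersingular.PollackConstantTerm
import Literature.NumberTheory.EllipticCurves.PlusMinusPAdicLFunctionProofs
import HarnessLib

/-!
# Sprung's ♯/♭ `p`-adic `L`-functions: the constant terms `L♯(0) = (−a_p²+2a_p+p−1)·[0]⁺_f`,
# `L♭(0) = (2−a_p)·[0]⁺_f` PROVED from the Mazur–Tate characterisation, and agreement with Pollack's
# `L^±` at `a_p = 0` (cell `b2b-bsdres`, supersingular family, prover B = unit `b2b-bsdres-additive-p3`, gen 3)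

HONEST FRAMING (run/shared/lean/b2b/bsd-rank1-residual/, verbatim in every file): the goal of the
cell is to DELETE the COMBINATION-SHAPED residual classes of the Birch–Swinnerton-Dyer formula for
ALL analytic-rank `≤ 1` elliptic curves over `ℚ` — "full BSD formula for every rank `≤ 1` curve in
class `C`" assembled STRICTLY from published theorems — so that the rank-`≤ 1` remainder becomes
exactly the CONSTRUCTION-SHAPED classes, which are TYPED (missing-input `Prop`s), NOT attempted.
This is not "finishing BSD". THEOREMS ONLY (no definition, no named fact, nothing about any curve is
asserted); no label of the cell moves (X8 stays CONSTRUCTION-SHAPED).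

## What this file does

`Literature/NumberTheory/EllipticCurves/Sprung2017/SharpFlatPAdicLFunction.lean` vendors Sprung's
♯/♭ `p`-adic `L`-functions (Sprung, Algebra Number Theory 11 (2017), Thm. 1.12 with Cor. 4.4–4.5)
in their Mazur–Tate form: `IsSprungPair f p a_p L♯ L♭` ⟺ `θ_n ≡ −(u_n L♯ + v_n L♭) (mod ω_n)` in
`Λ ⊗ ℚ_p` for all `n`, with the recursion polynomials `u_n = sharpPoly`, `v_n = flatPoly`
(`x_n = a_p x_{n−1} − Φ_{p^{n−1}}(1+T) x_{n−2}`). Its agreement with the tree's Pollack fact at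
`a_p = 0` (`L♯ = L⁺`, `L♭ = L⁻`) is PROVED in `Supersingular/SprungPollackConsistency.lean`. This
file PROVES, for ANY pair satisfying the characterisation (so in particular for Sprung's):

* `sum_fin_ratPlusSymbol_eq`, `sum_fiber_ratPlusSymbol_eq`, `sum_units_ratPlusSymbol_level_one_eq`,
  `sum_units_ratPlusSymbol_level_two_eq` — the Hecke (`U_p`) relation `a_p[r]⁺ = ∑_j[(r+j)/p]⁺ + [pr]⁺`
  and the unit sums `∑_{(ℤ/p)ˣ}[a/p]⁺ = (a_p − 2)[0]⁺`, `∑_{(ℤ/p²)ˣ}[a/p²]⁺ = (a_p² − 2a_p − p + 1)[0]⁺`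
  for ANY `a_p` (the `a_p = 0` cases are prover A's `PollackConstantTerm.lean`, p208966);
* `constantCoeff_flat_of_isCongrModOmega_zero`: **`L♭(0) = (2 − a_p)·[0]⁺_f`** (level `0`: `θ_0(0) = −L♭(0)`),
  `constantCoeff_sharp_of_isCongrModOmega_one`: **`L♯(0) = (−a_p² + 2a_p + p − 1)·[0]⁺_f`** (level `1`:
  `θ_1(0) = −L♯(0)`), `constantCoeff_chromaticL_of_isSprungPair` (both, via `chromaticConst`) — i.e.
  the row "`p` odd, `i = 0`" of Sprung's table of special values (after Cor. 4.11) is a THEOREM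
  about every Sprung pair in the tree's `Ω⁺_f`-normalisation (`[0]⁺_f = ratPlusSymbol f 0 =
  L(f,1)/Ω⁺_f`). For the newform of an elliptic curve `a_p = W.frobeniusTrace p`
  (`constantCoeff_chromaticL_of_isSprungPair_of_isNewformOf`).

* `sprung_thm112_of_frobeniusTrace_eq_zero` — at `a_p = 0` the named fact
  `Sprung2017.thm112_exists_isSprungPair` is a THEOREM (Pollack's existence theorem is the tree
  theorem `pollack_exists_plusMinusPAdicLFunction_holds`, harvest-2 p211931), so its debt is confined
  to `a_p ≠ 0`, i.e. (odd `p`, curves over `ℚ`) to class X8.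

Consequence for class X8 (`p = 3`, `a_3 = ±3`): `c_♯ ∈ {−1, −13}`, `c_♭ ∈ {−1, 5}` are `3`-adic
units, so BOTH colours interpolate `L(E,1)/Ω` up to a unit — the binder (P•) of the X8 rank-`0`
chain (`Supersingular/SharpFlatRankZero.lean`, p207337) is DISCHARGED on the real objects
(`Supersingular/SharpFlatRankZeroReal.lean`, this gen).

References: [Sprung2017] Thm. 1.12, Cor. 4.4–4.5, Cor. 4.10–4.11 and the table of special values;
[Pollack2003] Prop. 6.18; [Kobayashi2003] (3.6); [MazurTateTeitelbaum1986Invent] §I.4 (4.2), §I.8.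
-/

set_option autoImplicit false

noncomputable section

open scoped Classical MatrixGroups ModularForm

open CongruenceSubgroup Polynomial WeierstrassCurve Literature.NumberTheory.EllipticCurves
  Literature.NumberTheory.EllipticCurves.ModularForms
  Literature.NumberTheory.EllipticCurves.Sprung2017

namespace Summit.BirchSwinnertonDyer.Rank1Residual.Supersingular

/-! ### Unit sums of modular symbols at a good prime, any `a_p` -/

section UnitSums

variable {N : ℕ} [NeZero N] {f : CuspForm (Gamma0 N) 2} {p : ℕ} [Fact p.Prime]

/-- **The `U_p`-relation**: `∑_{j mod p} [(r + j)/p]⁺_f = a_p·[r]⁺_f − [p r]⁺_f` for a rational newform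
`f` of level prime to `p` with `a_p(f) = ap ∈ ℤ` (Mazur–Tate–Teitelbaum 1986, §I.4 (4.2):
`a_p [r]⁺ = ∑_j [(r+j)/p]⁺ + [p r]⁺`; tree `intCast_mul_ratPlusSymbol` with Manin–Drinfeld
rationality `ratCast_ratPlusSymbol_holds`). (`a_p = 0`: `sum_fin_ratPlusSymbol_eq_neg_of_ap_zero`.)
[cite: MazurTateTeitelbaum1986Invent, §I.4 (4.2)] -/
theorem sum_fin_ratPlusSymbol_eq (hf : IsNewform0 f) (hQ : coeffField f = ⊥)
    (hpN : ¬ p ∣ N) {ap : ℤ} (hap : cuspCoeff f p = ap) (r : ℚ) :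
    ∑ j : Fin p, ratPlusSymbol f ((r + j) / p) = (ap : ℚ) * ratPlusSymbol f r - ratPlusSymbol f (p * r) := by
  have hrat : ∀ r : ℚ, (ratPlusSymbol f r : ℝ) = normalizedPlusSymbol f r :=
    fun r ↦ ratCast_ratPlusSymbol_holds hf hQ r
  have h := intCast_mul_ratPlusSymbol p hf (Fact.out : p.Prime) hpN hap hrat r
  linarith

/-- The sum of `[b/p^{n+1}]⁺` over the fibre of `ℤ/p^{n+1} → ℤ/pⁿ` above `a` is
`a_p·[a/pⁿ]⁺ − [p · (a/pⁿ)]⁺` (the fibre is `{a + pⁿ j}_{j<p}`, `filter_castHom_eq_image`, and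
`(a + pⁿ j)/p^{n+1} = (a/pⁿ + j)/p`). [cite: MazurTateTeitelbaum1986Invent, §I.10 Prop. (10.2)] -/
theorem sum_fiber_ratPlusSymbol_eq (hf : IsNewform0 f) (hQ : coeffField f = ⊥)
    (hpN : ¬ p ∣ N) {ap : ℤ} (hap : cuspCoeff f p = ap) (n : ℕ) (a : ZMod (p ^ n)) :
    ∑ b ∈ Finset.univ.filter (fun b : ZMod (p ^ (n + 1)) ↦
        ZMod.castHom (pow_dvd_pow p n.le_succ) (ZMod (p ^ n)) b = a),
      ratPlusSymbol f ((b.val : ℚ) / (p : ℚ) ^ (n + 1)) =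
      (ap : ℚ) * ratPlusSymbol f ((a.val : ℚ) / (p : ℚ) ^ n) -
        ratPlusSymbol f ((p : ℚ) * ((a.val : ℚ) / (p : ℚ) ^ n)) := by
  classical
  haveI : NeZero p := ⟨(Fact.out : p.Prime).ne_zero⟩
  have hp : p.Prime := Fact.out
  have hp0 : (p : ℚ) ≠ 0 := by exact_mod_cast hp.ne_zero
  have hinj : Function.Injective
      (fun j : Fin p ↦ ((a.val + p ^ n * (j : ℕ) : ℕ) : ZMod (p ^ (n + 1)))) := by
    intro j j' h
    have hv := congr_arg ZMod.val h
    simp only [val_classLift] at hv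
    exact Fin.ext (Nat.eq_of_mul_eq_mul_left (pow_pos hp.pos n) (by omega))
  rw [filter_castHom_eq_image, Finset.sum_image fun j _ j' _ h ↦ hinj h,
    ← sum_fin_ratPlusSymbol_eq hf hQ hpN hap]
  refine Finset.sum_congr rfl fun j _ ↦ ?_
  rw [val_classLift]
  congr 1
  push_cast
  field_simp
  ring

/-- **`∑_{a ∈ (ℤ/p)ˣ} [a/p]⁺_f = (a_p − 2)·[0]⁺_f`** at a good prime: by the `U_p`-relation at `r = 0`,
`∑_{a mod p} [a/p]⁺ = a_p[0]⁺ − [0]⁺`, and the class `a = 0` contributes `[0]⁺`. (Level written `p^L`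
with `L = 0 + 1`, as in `sum_units_ratPlusSymbol_level_one`.) [cite: MazurTateTeitelbaum1986Invent, §I.4 (4.2)] -/
theorem sum_units_ratPlusSymbol_level_one_eq (hf : IsNewform0 f) (hQ : coeffField f = ⊥)
    (hpN : ¬ p ∣ N) {ap : ℤ} (hap : cuspCoeff f p = ap) (L : ℕ) (hL : L = 0 + 1) :
    ∑ u : (ZMod (p ^ L))ˣ, ratPlusSymbol f (((u : ZMod (p ^ L)).val : ℚ) / (p : ℚ) ^ L) =
      ((ap : ℚ) - 2) * ratPlusSymbol f 0 := by
  classical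
  subst hL
  haveI : NeZero (p ^ (0 + 1)) := ⟨pow_ne_zero _ (Fact.out : p.Prime).ne_zero⟩
  -- the whole level-`p` sum is the fibre over the unique class modulo `p^0`
  have hall : ∑ b : ZMod (p ^ (0 + 1)), ratPlusSymbol f ((b.val : ℚ) / (p : ℚ) ^ (0 + 1)) =
      (ap : ℚ) * ratPlusSymbol f 0 - ratPlusSymbol f 0 := by
    haveI : Subsingleton (ZMod (p ^ 0)) := (ZMod.subsingleton_iff).mpr (pow_zero p)
    have hfil : Finset.univ.filter (fun b : ZMod (p ^ (0 + 1)) ↦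
        ZMod.castHom (pow_dvd_pow p (Nat.le_succ 0)) (ZMod (p ^ 0)) b = 0) = Finset.univ :=
      Finset.filter_true_of_mem fun b _ ↦ Subsingleton.elim _ _
    have h := sum_fiber_ratPlusSymbol_eq hf hQ hpN hap 0 (0 : ZMod (p ^ 0))
    rw [hfil] at h
    rw [h, ZMod.val_zero, Nat.cast_zero, zero_div, mul_zero]
  -- units = non-zero classes
  rw [sum_units_eq_sum_filter_isUnit (F := fun b : ZMod (p ^ (0 + 1)) ↦
      ratPlusSymbol f ((b.val : ℚ) / (p : ℚ) ^ (0 + 1)))]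
  have hfil : Finset.univ.filter (fun a : ZMod (p ^ (0 + 1)) ↦ IsUnit a) = Finset.univ.erase 0 := by
    ext a
    simp [isUnit_iff_ne_zero_level_one]
  rw [hfil, Finset.sum_erase_eq_sub (Finset.mem_univ _), hall, ZMod.val_zero, Nat.cast_zero,
    zero_div]
  ring

/-- **`∑_{a ∈ (ℤ/p²)ˣ} [a/p²]⁺_f = (a_p² − 2a_p − p + 1)·[0]⁺_f`** at a good prime: group the units
modulo `p²` by their residue `a` modulo `p` (a unit); each fibre gives `a_p[a/p]⁺ − [a]⁺ =
a_p[a/p]⁺ − [0]⁺` (`[r + n]⁺ = [r]⁺`); summing over the `p − 1` units modulo `p` and using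
`sum_units_ratPlusSymbol_level_one_eq` gives `a_p(a_p − 2)[0]⁺ − (p−1)[0]⁺`. (Level `p^L`, `L = 1 + 1`.)
[cite: MazurTateTeitelbaum1986Invent, §I.4 (4.2)] -/
theorem sum_units_ratPlusSymbol_level_two_eq (hf : IsNewform0 f) (hQ : coeffField f = ⊥)
    (hpN : ¬ p ∣ N) {ap : ℤ} (hap : cuspCoeff f p = ap) (L : ℕ) (hL : L = 1 + 1) :
    ∑ u : (ZMod (p ^ L))ˣ, ratPlusSymbol f (((u : ZMod (p ^ L)).val : ℚ) / (p : ℚ) ^ L) =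
      ((ap : ℚ) ^ 2 - 2 * ap - p + 1) * ratPlusSymbol f 0 := by
  classical
  subst hL
  have hp : p.Prime := Fact.out
  haveI : NeZero (p ^ (1 + 1)) := ⟨pow_ne_zero _ hp.ne_zero⟩
  haveI : NeZero (p ^ 1) := ⟨pow_ne_zero _ hp.ne_zero⟩
  haveI : NeZero (p ^ (0 + 1)) := ⟨pow_ne_zero _ hp.ne_zero⟩
  have hp0 : (p : ℚ) ≠ 0 := by exact_mod_cast hp.ne_zero
  set F : ZMod (p ^ (1 + 1)) → ℚ := fun b ↦
    ratPlusSymbol f ((b.val : ℚ) / (p : ℚ) ^ (1 + 1)) with hF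
  set π := ZMod.castHom (pow_dvd_pow p (Nat.le_succ 1)) (ZMod (p ^ 1)) with hπ
  rw [sum_units_eq_sum_filter_isUnit (F := F), Finset.sum_filter,
    ← Finset.sum_fiberwise Finset.univ π
      (fun b : ZMod (p ^ (1 + 1)) ↦ if IsUnit b then F b else 0)]
  -- each fibre over a unit `a mod p` contributes `a_p[a/p]⁺ − [0]⁺`, the others `0`
  have hfib : ∀ a : ZMod (p ^ 1),
      ∑ b ∈ Finset.univ.filter (fun b : ZMod (p ^ (1 + 1)) ↦ π b = a),
        (if IsUnit b then F b else 0) =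
        if IsUnit a then (ap : ℚ) * ratPlusSymbol f ((a.val : ℚ) / (p : ℚ) ^ 1) - ratPlusSymbol f 0
        else 0 := by
    intro a
    have hiff : ∀ b ∈ Finset.univ.filter (fun b : ZMod (p ^ (1 + 1)) ↦ π b = a),
        IsUnit b ↔ IsUnit a := by
      intro b hb
      have hba : π b = a := (Finset.mem_filter.mp hb).2
      rw [isUnit_iff_isUnit_castHom (p := p) le_rfl (Nat.le_succ 1) b, ← hπ, hba]
    by_cases ha : IsUnit a
    · rw [if_pos ha, Finset.sum_congr rfl fun b hb ↦ if_pos ((hiff b hb).mpr ha), hπ,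
        sum_fiber_ratPlusSymbol_eq hf hQ hpN hap 1 a]
      have harg : (p : ℚ) * ((a.val : ℚ) / (p : ℚ) ^ 1) = ((0 : ℚ) + ((a.val : ℤ) : ℚ)) := by
        rw [pow_one (p : ℚ), mul_div_cancel₀ _ hp0]
        push_cast
        ring
      rw [harg, ratPlusSymbol_add_intCast_eq]
    · rw [if_neg ha]
      exact Finset.sum_eq_zero fun b hb ↦ if_neg (fun hb' ↦ ha ((hiff b hb).mp hb'))
  simp only [hfib]
  rw [← Finset.sum_filter, Finset.sum_sub_distrib, ← Finset.mul_sum, Finset.sum_const, nsmul_eq_mul]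
  -- the level-one unit sum, rewritten over the filter
  have hone : ∑ a ∈ Finset.univ.filter (fun a : ZMod (p ^ 1) ↦ IsUnit a),
      ratPlusSymbol f ((a.val : ℚ) / (p : ℚ) ^ 1) = ((ap : ℚ) - 2) * ratPlusSymbol f 0 := by
    rw [← sum_units_eq_sum_filter_isUnit (F := fun b : ZMod (p ^ 1) ↦
      ratPlusSymbol f ((b.val : ℚ) / (p : ℚ) ^ 1))]
    exact sum_units_ratPlusSymbol_level_one_eq hf hQ hpN hap 1 rfl
  -- `#(ℤ/p)ˣ = p − 1`
  have hcard : (Finset.univ.filter (fun a : ZMod (p ^ 1) ↦ IsUnit a)).card = p - 1 := by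
    have hfil : Finset.univ.filter (fun a : ZMod (p ^ 1) ↦ IsUnit a) = Finset.univ.erase 0 := by
      ext a
      simp [isUnit_iff_ne_zero_level_one]
    rw [hfil, Finset.card_erase_of_mem (Finset.mem_univ _), Finset.card_univ, ZMod.card, pow_one]
  rw [hone, hcard]
  have h1 : 1 ≤ p := hp.one_lt.le
  push_cast [Nat.cast_sub h1]
  ring

end UnitSums

/-! ### The constant terms of `L♯` and `L♭` -/

section ConstantTerms

variable {N : ℕ} [NeZero N] {f : CuspForm (Gamma0 N) 2} {p : ℕ} [Fact p.Prime]

/-- **`L♭(0) = (2 − a_p)·[0]⁺_f`** — the `♭` entry of the row "`p` odd, `i = 0`" of Sprung's table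
of special values (2017, after Cor. 4.11: `L_p^♭(f,0) = (2 − a_p)·L(f,1)/Ω_f⁺`), PROVED for ANY pair
satisfying the level-`0` clause of the Mazur–Tate characterisation (`θ_0 ≡ −(u_0 L♯ + v_0 L♭) =
−L♭ (mod ω_0 = T)`, so `θ_0(0) = −L♭(0)`) at an odd prime `p ∤ N` for a rational newform `f` with
`a_p(f) = ap`: `θ_0(0) = ∑_{a ∈ (ℤ/p)ˣ}[a/p]⁺ = (a_p − 2)[0]⁺`. (`[0]⁺_f = ratPlusSymbol f 0 = L(f,1)/Ω⁺_f`.)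
[cite: Sprung2017, Cor. 4.11 (table of special values) and Cor. 4.4] -/
theorem constantCoeff_flat_of_isCongrModOmega_zero (hp : p ≠ 2) (hf : IsNewform0 f)
    (hQ : coeffField f = ⊥) (hpN : ¬ p ∣ N) {ap : ℤ} (hap : cuspCoeff f p = ap)
    {Lsharp Lflat : IwasawaAlgebra p}
    (h0 : IsCongrModOmega p 0 (mazurTateElement f p 0) (-1)
      (toIwasawa p (sharpPoly ap p 0) * Lsharp + toIwasawa p (flatPoly ap p 0) * Lflat)) :
    ((PowerSeries.constantCoeff Lflat : ℤ_[p]) : ℚ_[p]) =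
      (((2 - (ap : ℚ)) * ratPlusSymbol f 0 : ℚ) : ℚ_[p]) := by
  have h := algebraMap_eval_zero_eq_of_isCongrModOmega h0
  rw [mazurTateElement_eval_zero,
    sum_units_ratPlusSymbol_level_one_eq hf hQ hpN hap _ (zero_add_cyclotomicExponent_eq hp),
    map_add, constantCoeff_toIwasawa_mul, constantCoeff_toIwasawa_mul, sharpPoly_zero,
    flatPoly_zero] at h
  simp only [eval_neg, eval_one, eval_zero, Int.cast_zero, zero_mul, zero_add, Int.cast_one,
    one_mul, Int.cast_neg] at h
  rw [eq_ratCast] at h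
  push_cast at h ⊢
  linear_combination h

/-- **`L♯(0) = (−a_p² + 2a_p + p − 1)·[0]⁺_f`** — the `♯` entry of the row "`p` odd, `i = 0`" of
Sprung's table of special values (2017, after Cor. 4.11), PROVED for ANY pair satisfying the
level-`1` clause of the Mazur–Tate characterisation (`θ_1 ≡ −(u_1 L♯ + v_1 L♭) = −L♯ (mod ω_1)`, so
`θ_1(0) = −L♯(0)`): `θ_1(0) = ∑_{a ∈ (ℤ/p²)ˣ}[a/p²]⁺ = (a_p² − 2a_p − p + 1)[0]⁺`.
[cite: Sprung2017, Cor. 4.11 (table of special values) and Cor. 4.4] -/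
theorem constantCoeff_sharp_of_isCongrModOmega_one (hp : p ≠ 2) (hf : IsNewform0 f)
    (hQ : coeffField f = ⊥) (hpN : ¬ p ∣ N) {ap : ℤ} (hap : cuspCoeff f p = ap)
    {Lsharp Lflat : IwasawaAlgebra p}
    (h1 : IsCongrModOmega p 1 (mazurTateElement f p 1) (-1)
      (toIwasawa p (sharpPoly ap p 1) * Lsharp + toIwasawa p (flatPoly ap p 1) * Lflat)) :
    ((PowerSeries.constantCoeff Lsharp : ℤ_[p]) : ℚ_[p]) =
      (((-(ap : ℚ) ^ 2 + 2 * ap + p - 1) * ratPlusSymbol f 0 : ℚ) : ℚ_[p]) := by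
  have h := algebraMap_eval_zero_eq_of_isCongrModOmega h1
  rw [mazurTateElement_eval_zero,
    sum_units_ratPlusSymbol_level_two_eq hf hQ hpN hap _ (one_add_cyclotomicExponent_eq hp),
    map_add, constantCoeff_toIwasawa_mul, constantCoeff_toIwasawa_mul, sharpPoly_one,
    flatPoly_one] at h
  simp only [eval_neg, eval_one, eval_zero, Int.cast_zero, zero_mul, add_zero, Int.cast_one,
    one_mul, Int.cast_neg] at h
  rw [eq_ratCast] at h
  push_cast at h ⊢
  linear_combination h

/-- **(P•) on the real objects, PROVED**: for a Sprung pair `(L♯, L♭)` of a rational newform `f` of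
level prime to the odd prime `p`, with `a_p(f) = ap`, the constant term of `L^•` (`• ∈ {♯, ♭}`) is
`c_• · [0]⁺_f` in `ℚ_p`, `c_♯ = −a_p² + 2a_p + p − 1`, `c_♭ = 2 − a_p` (`chromaticConst`) — Sprung's
table of special values at the trivial character, in the tree's `Ω⁺_f`-normalisation.
[cite: Sprung2017, Cor. 4.11 (table of special values)] -/
theorem constantCoeff_chromaticL_of_isSprungPair (hp : p ≠ 2) (hf : IsNewform0 f)
    (hQ : coeffField f = ⊥) (hpN : ¬ p ∣ N) {ap : ℤ} (hap : cuspCoeff f p = ap)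
    {Lsharp Lflat : IwasawaAlgebra p} (hSP : IsSprungPair f p ap Lsharp Lflat) (c : Chroma) :
    ((PowerSeries.constantCoeff (chromaticL c Lsharp Lflat) : ℤ_[p]) : ℚ_[p]) =
      (chromaticConst p ap c : ℚ_[p]) * ((ratPlusSymbol f 0 : ℚ) : ℚ_[p]) := by
  cases c with
  | sharp =>
    rw [chromaticL_sharp, chromaticConst_sharp,
      constantCoeff_sharp_of_isCongrModOmega_one hp hf hQ hpN hap (hSP 1)]
    push_cast
    ring
  | flat =>
    rw [chromaticL_flat, chromaticConst_flat,
      constantCoeff_flat_of_isCongrModOmega_zero hp hf hQ hpN hap (hSP 0)]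
    push_cast
    ring

variable {W : WeierstrassCurve ℚ} [W.IsElliptic] [W.IsGloballyMinimal]

/-- **(P•) for the newform of an elliptic curve**: for `f` the newform of `W` (`IsNewformOf W f`),
`p` an odd prime of good reduction and ANY Sprung pair `(L♯, L♭)` for the trace `a_p(W)`:
`L^•(0) = c_•(a_p(W)) · [0]⁺_f` in `ℚ_p`. [cite: Sprung2017, Cor. 4.11 (table of special values)] -/
theorem constantCoeff_chromaticL_of_isSprungPair_of_isNewformOf (hp : p ≠ 2) (hf : IsNewformOf W f)
    (hgood : W.HasGoodReductionAtPrime p) {Lsharp Lflat : IwasawaAlgebra p}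
    (hSP : IsSprungPair f p (W.frobeniusTrace p) Lsharp Lflat) (c : Chroma) :
    ((PowerSeries.constantCoeff (chromaticL c Lsharp Lflat) : ℤ_[p]) : ℚ_[p]) =
      (chromaticConst p (W.frobeniusTrace p) c : ℚ_[p]) * ((ratPlusSymbol f 0 : ℚ) : ℚ_[p]) :=
  constantCoeff_chromaticL_of_isSprungPair hp hf.1 hf.coeffField_eq_bot (not_dvd_level_of_isNewformOf hf hgood)
    (cuspCoeff_eq_frobeniusTrace_of_isNewformOf_holds hf hgood) hSP c

omit [Fact p.Prime] in
/-- At `a_p = 0` the constants are Pollack's / Kobayashi's: `c_♯(0) = p − 1 = L⁺(0)/[0]⁺`,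
`c_♭(0) = 2 = L⁻(0)/[0]⁺` (cf. `constantCoeff_pollackPlus`, `constantCoeff_pollackMinus`).
[cite: Sprung2017, Cor. 4.11 (table of special values)] [cite: Kobayashi2003, (3.6) (p. 7)] -/
theorem chromaticConst_zero (c : Chroma) :
    chromaticConst p 0 c = (match c with | .sharp => (p : ℤ) - 1 | .flat => 2) := by
  cases c <;> simp

end ConstantTerms

/-! ### At `a_p = 0` Sprung's existence statement is a tree THEOREM -/

section Discharge

variable {W : WeierstrassCurve ℚ} [W.IsElliptic] [W.IsGloballyMinimal] {N : ℕ} [NeZero N]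
  {f : CuspForm (Gamma0 N) 2} {p : ℕ} [Fact p.Prime]

/-- **`Sprung2017.thm112_exists_isSprungPair` HOLDS whenever `a_p(E) = 0`**: Pollack's existence
theorem is a tree THEOREM (`pollack_exists_plusMinusPAdicLFunction_holds`, harvest-2 p211931: the
`L^±` are reconstructed algebraically from the Mazur–Tate elements), and at `a_p = 0` a Pollack pair IS
a Sprung pair (`isSprungPair_zero_iff`). So the named fact carries debt only for `a_p ≠ 0` — among
elliptic curves over `ℚ` at odd `p`, exactly class X8 (`p = 3`, `a_3 = ±3`).
[cite: Pollack2003, Thm. 5.6, Cor. 5.11 and Prop. 6.18] [cite: Sprung2017, Thm. 1.12 and §3.1] -/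
theorem sprung_thm112_of_frobeniusTrace_eq_zero (hap : W.frobeniusTrace p = 0) :
    Sprung2017.thm112_exists_isSprungPair (W := W) (f := f) (p := p) := by
  intro hp hf hgood _
  exact exists_isSprungPair_frobeniusTrace_of_pollack pollack_exists_plusMinusPAdicLFunction_holds hp
    hf hgood hap

/-- Unconditionally at `a_p = 0`: there is a Sprung pair `(L♯, L♭) = (L⁺, L⁻)` with both members
non-zero. [cite: Pollack2003, Thm. 5.6, Cor. 5.11 and Prop. 6.18] [cite: Sprung2017, Thm. 1.12 and §3.1] -/
theorem exists_isSprungPair_of_frobeniusTrace_eq_zero (hp : p ≠ 2) (hf : IsNewformOf W f)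
    (hgood : W.HasGoodReductionAtPrime p) (hap : W.frobeniusTrace p = 0) :
    ∃ Lsharp Lflat : IwasawaAlgebra p, Lsharp ≠ 0 ∧ Lflat ≠ 0 ∧ IsSprungPair f p 0 Lsharp Lflat :=
  exists_isSprungPair_of_pollack pollack_exists_plusMinusPAdicLFunction_holds hp hf hgood hap

end Discharge

end Summit.BirchSwinnertonDyer.Rank1Residual.Supersingular

end
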